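import Literature.AnabelianGeometry.EtaleTheta.Discharge.Sec1CuspInertiaTateTwist
import Literature.AnabelianGeometry.EtaleTheta.Discharge.Sec1DeltaThetaZHat
import Literature.AnabelianGeometry.EtaleTheta.ZHatLevelDetermination
import Literature.AnabelianGeometry.EtaleTheta.SettingModelCyclotomicCharacter
import HarnessLib

/-!
# [EtTh] §1 p. 12 «`(Ẑ(1) ≅) Δ_Θ`» EXACTLY: at `IsTateOrigin`, EVERY group isomorphism `ψ : Δ_Θ ≅ Ẑ` is
# `Π^tp_X`-equivariant for the cyclotomic character — `ψ(θ(σ) s θ(σ)⁻¹) = χ(aug σ) · ψ(s)` — and so is the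
# character of a cusp's decomposition group on (the `Θ`-image of) its inertia

Mochizuki, *The étale theta function and its Frobenioid-theoretic manifestations*, Publ. RIMS **45** (2009) [EtTh],
§1, kurims PDF p. 12 «we also have a natural exact sequence `1 → ∧² Δ^ell_X (≅ Ẑ(1)) → Δ^Θ_X → Δ^ell_X → 1` …
`(Ẑ(1) ≅) Δ_Θ ⊆ Δ^Θ_X`», p. 13 «`(Δ^tp_Y)^ell ≅ Ẑ(1)`», Def. 2.1 p. 35 «`D_x → Π^Θ_X` … maps the inertia group
`I_x ⊆ D_x` isomorphically onto `Δ_Θ`» [cite: MochizukiEtTh2009, §1 p.12]; [SemiAnbd] §6 p. 71 «`I_x ≅ Ẑ(1)`»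
[cite: MochizukiSemiAnbd2006, §6 p.71].  abc-iut cell, layer L2, seat abc-iut-w5-d051 (gen 4; NV / §1-interface
lane); PROOF-ONLY sequel of `Sec1CuspInertiaTateTwist.lean` (p452622).

WHAT.  The root interface `ThetaSetting` (abc-iut-L2-t1) lists «`Δ_Θ ≅ Ẑ(1)` as a `G_K`-module (the Tate twist)»
among its DEFERRED transcriptions (GAP row G-w4d041-1); the cell carries the twist as a DATUM
(abc-iut-L2-t8's `CyclotomeMod` / `CyclotomeTower`; abc-iut-L2-t8's `Sec2CyclotomeModOfTateTwist` takes as INPUT a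
trivialisation `e : Δ_Θ → Ẑ` with `e(g d g⁻¹) = χ(aug g) · e(d)`).  The GROUP structure `Δ_Θ ≃* Ẑ` is a theorem
under the guard `IsEtThOrigin` + the closedness binder `hYcl` (`IsEtThOrigin.nonempty_deltaTheta_mulEquiv_zHat`,
w5-d006/L2-d1/w5-d171).  HERE, from abc-iut-w5-d051's Tate-module clause `IsTateOrigin` (the typed p. 13 structure of
`(Δ^tp_Y)^ell`), the EQUIVARIANCE is DERIVED, exactly and for every trivialisation at once:

* **`ThetaSetting.IsTateOrigin.mulEquiv_conjNormal_eq_chi`** — at `IsEtThOrigin` + `hYcl` + `IsTateOrigin`, for EVERY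
  group isomorphism `ψ : Δ_Θ ≃* Ẑ`, every `σ ∈ Π^tp_X` and every `s ∈ Δ_Θ`:
  `ψ (θ(σ) s θ(σ)⁻¹) = χ(aug σ) (ψ s)`, where `χ = SettingModel.chi p : G_{ℚ_p} → Aut(Ẑ)` is THE cyclotomic character
  (abc-iut-w5-d091; `σ ζ = ζ^{χ_N(σ)}` on roots of unity).  Proof: an element of `Ẑ` is determined by its levels
  (`ZHatLevel.ext_of_level`); at level `N`, p452622's `conj_deltaTheta_tateTwist` gives `θ(σ) s θ(σ)⁻¹ = e^N s^k` with
  `σ ζ_N = ζ_N^k`, so both sides have level `k · level_N(ψ s) = χ_N(σ) · level_N(ψ s)`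
  (`ZHatLevel.toAdd_level_aut`, `levelChar_chi_eq_of_isPrimitiveRoot`).  Since `Aut(Ẑ)` is abelian the law does not
  depend on `ψ` — «`Δ_Θ ≅ Ẑ(1)`» is a PROPERTY of `Δ_Θ` at a Tate origin, not a choice;
* `ThetaSetting.IsTateOrigin.exists_mulEquiv_conjNormal_eq_chi` — hence the Tate-twist trivialisation EXISTS (the
  input shape of GAP row G-w4d041-1 / of `Sec2CyclotomeModOfTateTwist`, group-theoretic part);
* **`ThetaSetting.IsTateOrigin.inertiaCharacter_eq_chi`** — (+ R2 for every `N`) for every cuspidal decomposition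
  group `Dc ⊆ Π^tp_Y`: the homomorphism `e := ψ ∘ θ : Dc ∩ Δ^tp_X → Ẑ` (well defined by p451482's
  `θ(Dc ∩ Δ^tp_X) ⊆ Δ_Θ`) satisfies `e(d w d⁻¹) = χ(aug d) · e(w)` for EVERY `d ∈ Dc` — the decomposition group of a
  cusp acts on its inertia, read in the theta quotient, through the cyclotomic character («`I_x ≅ Ẑ(1)`», the
  `ThetaSetting`-side content of abc-iut-w5-d029's [GalSect] predicate `CuspPair.IsCyclotomic`); with the cusp law C3
  («`θ(I_x) = Δ_Θ`») `e` is moreover SURJECTIVE (`inertiaCharacter_surjective_of_cuspLaw`);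
* joint-origin forms `…_of_origins` (`IsThm16Origin ∧ IsTateOrigin`).

PROOF-ONLY: no definition, no instance, no named fact; nothing of another seat's file restated.  HONEST FRAMING:
interface law over the frozen root; `IsEtThOrigin`, `hYcl`, the origin predicates and C3 are hypotheses inhabited
only at models; nothing of [EtTh]/[SemiAnbd] is asserted for genuine tempered fundamental groups; no side is taken
on [IUTchIII] Cor. 3.12; typed ≠ proved.
-/

noncomputable section

namespace Literature.AnabelianGeometry.EtaleTheta

open Literature.AnabelianGeometry.SemiGraphs Thm16Sub
open scoped Pointwise

namespace ThetaSetting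

variable {p : ℕ} [Fact p.Prime] {D : ThetaSetting p}

/-! ### 1. «`Δ_Θ ≅ Ẑ(1)`» exactly, for every trivialisation -/

/-- **«`(Ẑ(1) ≅) Δ_Θ`» EXACTLY.**  At `IsEtThOrigin` + `hYcl` + `IsTateOrigin`, every group isomorphism `ψ : Δ_Θ ≃* Ẑ`
is equivariant for the cyclotomic character: `ψ(θ(σ) s θ(σ)⁻¹) = χ(aug σ) · ψ(s)` for all `σ ∈ Π^tp_X`, `s ∈ Δ_Θ`
(levelwise from p452622's mod-`N` law; `Ẑ` is determined by its levels). [cite: MochizukiEtTh2009, §1 p.12] -/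
theorem IsTateOrigin.mulEquiv_conjNormal_eq_chi (hO : D.IsEtThOrigin)
    (hYcl : (D.DtpY.map D.toHat.toMonoidHom).topologicalClosure ≤
      D.DtpY.map D.toHat.toMonoidHom ⊔ (⁅⁅D.DeltaHat, D.DeltaHat⁆, D.DeltaHat⁆).topologicalClosure)
    (hT : D.IsTateOrigin) (ψ : ↥D.DeltaTheta ≃* ZHat) (σ : D.PiTemp) (s : ↥D.DeltaTheta) :
    ψ (MulAut.conjNormal (D.toTheta σ) s) = SettingModel.chi p (D.aug σ) (ψ s) := by
  refine ZHatLevel.ext_of_level fun n => ?_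
  obtain ⟨ζ, hζ, H⟩ := hT.exists_primitiveRoot_conj_deltaTheta hO hYcl n
  obtain ⟨k, hk⟩ := exists_apply_eq_pow hζ (D.aug σ)
  obtain ⟨e, he, hconj⟩ := H σ k hk s s.2
  -- `ψ(conj s) = ψ(e)^n · ψ(s)^k`
  have h1 : ψ (MulAut.conjNormal (D.toTheta σ) s) = ψ ⟨e, he⟩ ^ (n : ℕ) * ψ s ^ k := by
    rw [← map_pow, ← map_pow, ← map_mul]
    congr 1
    apply Subtype.ext
    rw [MulAut.conjNormal_apply, Subgroup.coe_mul, Subgroup.coe_pow, Subgroup.coe_pow]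
    exact hconj
  apply Multiplicative.toAdd.injective
  rw [h1, map_mul, map_pow, map_pow, toAdd_mul, toAdd_pow, toAdd_pow, ZHatLevel.toAdd_level_aut,
    SettingModel.levelChar_chi_eq_of_isPrimitiveRoot p (D.aug σ) n hζ hk, nsmul_eq_mul, nsmul_eq_mul,
    ZMod.natCast_self, zero_mul, zero_add]

/-- The same with the conjugate written out in `(Π^tp_X)^Θ`. [cite: MochizukiEtTh2009, §1 p.12] -/
theorem IsTateOrigin.mulEquiv_conj_eq_chi (hO : D.IsEtThOrigin)
    (hYcl : (D.DtpY.map D.toHat.toMonoidHom).topologicalClosure ≤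
      D.DtpY.map D.toHat.toMonoidHom ⊔ (⁅⁅D.DeltaHat, D.DeltaHat⁆, D.DeltaHat⁆).topologicalClosure)
    (hT : D.IsTateOrigin) (ψ : ↥D.DeltaTheta ≃* ZHat) (σ : D.PiTemp) {s : D.GtpTheta} (hs : s ∈ D.DeltaTheta)
    (hs' : D.toTheta σ * s * (D.toTheta σ)⁻¹ ∈ D.DeltaTheta) :
    ψ ⟨D.toTheta σ * s * (D.toTheta σ)⁻¹, hs'⟩ = SettingModel.chi p (D.aug σ) (ψ ⟨s, hs⟩) := by
  have h := hT.mulEquiv_conjNormal_eq_chi hO hYcl ψ σ ⟨s, hs⟩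
  have heq : (⟨D.toTheta σ * s * (D.toTheta σ)⁻¹, hs'⟩ : ↥D.DeltaTheta) = MulAut.conjNormal (D.toTheta σ) ⟨s, hs⟩ :=
    Subtype.ext (by rw [MulAut.conjNormal_apply])
  rw [heq, h]

/-- **The Tate-twist trivialisation EXISTS** (group-theoretic part of the input datum of GAP row G-w4d041-1 /
abc-iut-L2-t8's `Sec2CyclotomeModOfTateTwist`): at `IsEtThOrigin` + `hYcl` + `IsTateOrigin` there is a group
isomorphism `ψ : Δ_Θ ≃* Ẑ` with `ψ(θ(σ) s θ(σ)⁻¹) = χ(aug σ) · ψ(s)` (any `ψ` works; existence of one by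
`IsEtThOrigin.nonempty_deltaTheta_mulEquiv_zHat`). [cite: MochizukiEtTh2009, §1 p.12] -/
theorem IsTateOrigin.exists_mulEquiv_conjNormal_eq_chi (hO : D.IsEtThOrigin)
    (hYcl : (D.DtpY.map D.toHat.toMonoidHom).topologicalClosure ≤
      D.DtpY.map D.toHat.toMonoidHom ⊔ (⁅⁅D.DeltaHat, D.DeltaHat⁆, D.DeltaHat⁆).topologicalClosure)
    (hT : D.IsTateOrigin) :
    ∃ ψ : ↥D.DeltaTheta ≃* ZHat, ∀ (σ : D.PiTemp) (s : ↥D.DeltaTheta),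
      ψ (MulAut.conjNormal (D.toTheta σ) s) = SettingModel.chi p (D.aug σ) (ψ s) := by
  obtain ⟨ψ⟩ := hO.nonempty_deltaTheta_mulEquiv_zHat hYcl
  exact ⟨ψ, fun σ s => hT.mulEquiv_conjNormal_eq_chi hO hYcl ψ σ s⟩

/-! ### 2. The character of a cusp's decomposition group on its inertia is the cyclotomic character -/

/-- The inertia `Dc ∩ Δ^tp_X` of a cuspidal decomposition group `Dc` is normalised by `Dc`.
[cite: MochizukiSemiAnbd2006, §6 p.71] -/
theorem conj_mem_inf_deltaTemp {Dc : Subgroup D.PiTemp} {d w : D.PiTemp} (hd : d ∈ Dc)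
    (hw : w ∈ Dc ⊓ D.DeltaTemp) : d * w * d⁻¹ ∈ Dc ⊓ D.DeltaTemp := by
  obtain ⟨hwc, hwΔ⟩ := Subgroup.mem_inf.mp hw
  exact Subgroup.mem_inf.mpr ⟨Dc.mul_mem (Dc.mul_mem hd hwc) (Dc.inv_mem hd),
    (inferInstanceAs D.aug.toMonoidHom.ker.Normal : D.DeltaTemp.Normal).conj_mem w hwΔ d⟩

/-- **The character of `Dc` on (the `Θ`-image of) its inertia IS the cyclotomic character.**  At `IsEtThOrigin` +
`hYcl` + `IsTateOrigin` + R2 (every `N`), for a cuspidal decomposition group `Dc ⊆ Π^tp_Y`, any `ψ : Δ_Θ ≃* Ẑ`,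
`d ∈ Π^tp_X` and `w ∈ Dc ∩ Δ^tp_X` (whose `Θ`-images lie in `Δ_Θ` by p451482):
`ψ(θ(d w d⁻¹)) = χ(aug d) · ψ(θ(w))` («`I_x ≅ Ẑ(1)`», [SemiAnbd] §6 p. 71, read in `Π^Θ_X`).
[cite: MochizukiEtTh2009, Def 2.1 p.35] -/
theorem IsTateOrigin.inertiaCharacter_eq_chi (hO : D.IsEtThOrigin)
    (hYcl : (D.DtpY.map D.toHat.toMonoidHom).topologicalClosure ≤
      D.DtpY.map D.toHat.toMonoidHom ⊔ (⁅⁅D.DeltaHat, D.DeltaHat⁆, D.DeltaHat⁆).topologicalClosure)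
    (hT : D.IsTateOrigin) (hR2 : ∀ N : ℕ+, GtpYNFromCusp D N) {Dc : Subgroup D.PiTemp}
    (hDc : D.IsCuspidalDecompositionGroup Dc) (hDcY : Dc ≤ D.GtpY) (ψ : ↥D.DeltaTheta ≃* ZHat)
    (d : D.PiTemp) {w : D.PiTemp} (hw : w ∈ Dc ⊓ D.DeltaTemp) :
    ∃ (h₁ : D.toTheta (d * w * d⁻¹) ∈ D.DeltaTheta) (h₂ : D.toTheta w ∈ D.DeltaTheta),
      ψ ⟨D.toTheta (d * w * d⁻¹), h₁⟩ = SettingModel.chi p (D.aug d) (ψ ⟨D.toTheta w, h₂⟩) := by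
  have h₂ : D.toTheta w ∈ D.DeltaTheta := hT.map_toTheta_inertia_le_deltaTheta hR2 hDc hDcY ⟨w, hw, rfl⟩
  have h₁' : D.toTheta d * D.toTheta w * (D.toTheta d)⁻¹ ∈ D.DeltaTheta :=
    (inferInstance : D.DeltaTheta.Normal).conj_mem _ h₂ _
  have heq : D.toTheta (d * w * d⁻¹) = D.toTheta d * D.toTheta w * (D.toTheta d)⁻¹ := by
    rw [map_mul, map_mul, map_inv]
  have h₁ : D.toTheta (d * w * d⁻¹) ∈ D.DeltaTheta := heq ▸ h₁'
  refine ⟨h₁, h₂, ?_⟩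
  have h := hT.mulEquiv_conj_eq_chi hO hYcl ψ d h₂ h₁'
  have hsub : (⟨D.toTheta (d * w * d⁻¹), h₁⟩ : ↥D.DeltaTheta) =
      ⟨D.toTheta d * D.toTheta w * (D.toTheta d)⁻¹, h₁'⟩ := Subtype.ext heq
  rw [hsub, h]

/-- **Packaged as a character on the inertia**: at `IsEtThOrigin` + `hYcl` + `IsTateOrigin` + R2, for every cuspidal
`Dc ⊆ Π^tp_Y` and every `ψ : Δ_Θ ≃* Ẑ` the group homomorphism `e := ψ ∘ θ : Dc ∩ Δ^tp_X → Ẑ` (tied to `θ` by the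
first clause) satisfies `e(d w d⁻¹) = χ(aug d) · e(w)` for all `d ∈ Dc` — the `ThetaSetting`-side content of «the
cusp is cyclotomic» (abc-iut-w5-d029's [GalSect] `CuspPair.IsCyclotomic`, without the topological-isomorphism clause).
[cite: MochizukiEtTh2009, Def 2.1 p.35] -/
theorem IsTateOrigin.exists_inertiaCharacter (hO : D.IsEtThOrigin)
    (hYcl : (D.DtpY.map D.toHat.toMonoidHom).topologicalClosure ≤
      D.DtpY.map D.toHat.toMonoidHom ⊔ (⁅⁅D.DeltaHat, D.DeltaHat⁆, D.DeltaHat⁆).topologicalClosure)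
    (hT : D.IsTateOrigin) (hR2 : ∀ N : ℕ+, GtpYNFromCusp D N) {Dc : Subgroup D.PiTemp}
    (hDc : D.IsCuspidalDecompositionGroup Dc) (hDcY : Dc ≤ D.GtpY) (ψ : ↥D.DeltaTheta ≃* ZHat) :
    ∃ e : ↥(Dc ⊓ D.DeltaTemp) →* ZHat,
      (∀ w : ↥(Dc ⊓ D.DeltaTemp), ∃ h : D.toTheta (w : D.PiTemp) ∈ D.DeltaTheta, e w = ψ ⟨D.toTheta w, h⟩) ∧
      ∀ (d : D.PiTemp) (hd : d ∈ Dc) (w : ↥(Dc ⊓ D.DeltaTemp)),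
        e ⟨d * w * d⁻¹, conj_mem_inf_deltaTemp hd w.2⟩ = SettingModel.chi p (D.aug d) (e w) := by
  have hle : (Dc ⊓ D.DeltaTemp).map D.toTheta ≤ D.DeltaTheta := hT.map_toTheta_inertia_le_deltaTheta hR2 hDc hDcY
  -- `e := ψ ∘ (θ restricted to the inertia, corestricted to Δ_Θ)`
  set e : ↥(Dc ⊓ D.DeltaTemp) →* ZHat :=
    ψ.toMonoidHom.comp ((Subgroup.inclusion hle).comp ((D.toTheta).subgroupMap (Dc ⊓ D.DeltaTemp))) with he_def
  have he : ∀ (w : ↥(Dc ⊓ D.DeltaTemp)) (h : D.toTheta (w : D.PiTemp) ∈ D.DeltaTheta),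
      e w = ψ ⟨D.toTheta w, h⟩ := fun w h => rfl
  refine ⟨e, fun w => ⟨hle ⟨w, w.2, rfl⟩, he w _⟩, fun d hd w => ?_⟩
  obtain ⟨h₁, h₂, h⟩ := hT.inertiaCharacter_eq_chi hO hYcl hR2 hDc hDcY ψ d w.2
  rw [he _ h₁, he w h₂, h]

/-- **With the cusp law C3 the inertia character is ONTO `Ẑ`**: if `θ(Dc ∩ Δ^tp_X) = Δ_Θ` then `ψ ∘ θ` maps the
inertia onto `Ẑ` («`I_x` maps isomorphically onto `Δ_Θ ≅ Ẑ(1)`»). [cite: MochizukiEtTh2009, Def 2.1 p.35] -/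
theorem inertiaCharacter_surjective_of_cuspLaw {Dc : Subgroup D.PiTemp}
    (hC3 : (Dc ⊓ D.DeltaTemp).map D.toTheta = D.DeltaTheta) (ψ : ↥D.DeltaTheta ≃* ZHat) :
    ∃ e : ↥(Dc ⊓ D.DeltaTemp) →* ZHat, Function.Surjective e ∧
      ∀ w : ↥(Dc ⊓ D.DeltaTemp), ∃ h : D.toTheta (w : D.PiTemp) ∈ D.DeltaTheta, e w = ψ ⟨D.toTheta w, h⟩ := by
  have hle : (Dc ⊓ D.DeltaTemp).map D.toTheta ≤ D.DeltaTheta := hC3.le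
  set e : ↥(Dc ⊓ D.DeltaTemp) →* ZHat :=
    ψ.toMonoidHom.comp ((Subgroup.inclusion hle).comp ((D.toTheta).subgroupMap (Dc ⊓ D.DeltaTemp))) with he_def
  have he : ∀ (w : ↥(Dc ⊓ D.DeltaTemp)) (h : D.toTheta (w : D.PiTemp) ∈ D.DeltaTheta),
      e w = ψ ⟨D.toTheta w, h⟩ := fun w h => rfl
  refine ⟨e, ?_, fun w => ⟨hle ⟨w, w.2, rfl⟩, he w _⟩⟩
  intro t
  obtain ⟨s, hs⟩ := ψ.surjective t
  have hs' : (s : D.GtpTheta) ∈ (Dc ⊓ D.DeltaTemp).map D.toTheta := by rw [hC3]; exact s.2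
  obtain ⟨w, hw, hws⟩ := hs'
  refine ⟨⟨w, hw⟩, ?_⟩
  rw [he ⟨w, hw⟩ (hws ▸ s.2), ← hs]
  congr 1
  exact Subtype.ext hws

/-! ### 3. Joint-origin forms -/

/-- **Joint-origin form** (`IsThm16Origin ∧ IsTateOrigin`): every `ψ : Δ_Θ ≃* Ẑ` is `χ`-equivariant.
[cite: MochizukiEtTh2009, §1 p.12] -/
theorem mulEquiv_conjNormal_eq_chi_of_origins (hO : D.IsEtThOrigin)
    (hYcl : (D.DtpY.map D.toHat.toMonoidHom).topologicalClosure ≤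
      D.DtpY.map D.toHat.toMonoidHom ⊔ (⁅⁅D.DeltaHat, D.DeltaHat⁆, D.DeltaHat⁆).topologicalClosure)
    (_h16 : D.IsThm16Origin) (hT : D.IsTateOrigin) (ψ : ↥D.DeltaTheta ≃* ZHat) (σ : D.PiTemp)
    (s : ↥D.DeltaTheta) :
    ψ (MulAut.conjNormal (D.toTheta σ) s) = SettingModel.chi p (D.aug σ) (ψ s) :=
  hT.mulEquiv_conjNormal_eq_chi hO hYcl ψ σ s

/-- **Joint-origin form** of the inertia character law (R2 from `IsThm16Origin`). [cite: MochizukiEtTh2009, Def 2.1 p.35] -/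
theorem inertiaCharacter_eq_chi_of_origins (hO : D.IsEtThOrigin)
    (hYcl : (D.DtpY.map D.toHat.toMonoidHom).topologicalClosure ≤
      D.DtpY.map D.toHat.toMonoidHom ⊔ (⁅⁅D.DeltaHat, D.DeltaHat⁆, D.DeltaHat⁆).topologicalClosure)
    (h16 : D.IsThm16Origin) (hT : D.IsTateOrigin) {Dc : Subgroup D.PiTemp}
    (hDc : D.IsCuspidalDecompositionGroup Dc) (hDcY : Dc ≤ D.GtpY) (ψ : ↥D.DeltaTheta ≃* ZHat)
    (d : D.PiTemp) {w : D.PiTemp} (hw : w ∈ Dc ⊓ D.DeltaTemp) :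
    ∃ (h₁ : D.toTheta (d * w * d⁻¹) ∈ D.DeltaTheta) (h₂ : D.toTheta w ∈ D.DeltaTheta),
      ψ ⟨D.toTheta (d * w * d⁻¹), h₁⟩ = SettingModel.chi p (D.aug d) (ψ ⟨D.toTheta w, h₂⟩) :=
  hT.inertiaCharacter_eq_chi hO hYcl h16.gtpYN_fromCusp hDc hDcY ψ d hw

end ThetaSetting

end Literature.AnabelianGeometry.EtaleTheta

end
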